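import Summits.CriticalPhenomena.PercolationContinuityZ3.Theorems.PercNearOneGluingNoHeavyLowerTailIncStarBranchLemmaStep
import Summits.CriticalPhenomena.PercolationContinuityZ3.Theorems.PercNearOneGluingNoHeavyLowerTailIncStarApexForestSchema
import HarnessLib

/-!
# The BRANCH LEMMA (Br) of the apex-forest calculus, II: the induction over the forest

Support file for the Sahi programme (`--supports stmt-CriticalPhenomena-4575`, prover prim-sahi-p2 gen 19).  No definitions, no named
facts, no sorries; standard axioms.  Memo `run/shared/lean/prim/prim-sahi/FROM-prim-nh-lead-4575-g120-STAR-HALF.md` §5(iv), §8 (lead g120)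
and `prim-sahi-p2/PROOF-E3.md` (29d′)/(29f).

**Theorem `branchLemma` ((Br) on every apex-forest).**  For product Bernoulli percolation `P = prodBernoulli w` on the pairs of `Fin n` with root
`s`, a port `w₀ ≠ s` and any vertex `t`: if the environment `fromEdgeSet {z | s ∉ z ∧ w z ≠ 0}` is acyclic, then
  `P(w₀↛s)·P(t↔w₀ ∨ s↔t) ≤ P(t↔w₀ ∧ w₀↛s) + 2·P(w₀↛s ∧ t↮w₀ ∧ s↔t)`,
the lead's `D + 2H ≥ A(π + G)` in root-connection form (`D = P(t↔w₀ ∧ w₀↛s)`, `H = P(w₀↛s ∧ t↮w₀ ∧ s↔t)`, `A = P(w₀↛s)`,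
`P(Z) = P(t↔w₀ ∨ s↔t)`).  Equivalently `Cov(1{w₀↔s}, 1{t↔w₀ ∨ t↔s}) ≤ P(w₀↛s ∧ t↮w₀ ∧ s↔t)` — Harris only gives `0 ≤` on the left; the
inequality is false for environments with cycles (`K₄ − e`), and is, with van den Berg–Kahn's Theorem 1.1 (= the lead's (PA)), the analytic
input of the R-side lemma of THEOREM C½ and of THEOREM (I2′)-tree.

**Proof.**  Induction on the number of positive environment pairs.  `t = w₀`: equality.  `t` not in the tree of `w₀`: the component `L` of
`w₀` is joined to the rest only through the root, so `{t↔w₀} = {t↔s} ∩ {s↔w₀}` a.s. and `{s↔w₀}`, `{s↔t}` are independent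
(`IncStar.indep_blocks`): the inequality reads `A·m ≤ 0 + 2A·m`.  Otherwise let `x₁` be the neighbour of `w₀` on the tree path to `t`
(`SimpleGraph.Walk.bypass`); `e₁ = s(x₁, w₀)` is a bridge of the forest, its `x₁`-side `L` contains `t` and is joined to the rest only through
`e₁` and the root (`IncStar.apexForest_cross`), and `IncStar.branchLemma_bridge_step` reduces `(Br)(w; w₀, t)` to `(Br)(w[e₁↦0]; x₁, t)`,
an instance with fewer positive environment pairs and an acyclic environment (`IncStar.envGraph_update_le`).  ∎
-/

noncomputable section

namespace Summit.CriticalPhenomena.PercolationContinuityZ3.Theorems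

namespace IncStar

open MeasureTheory Set Literature.Probability.Percolation Literature.Probability.LatticeModels EdgeInduction
open scoped Classical

variable {n : ℕ}

/-- Pinning a positive environment pair to `0` lowers the number of positive environment pairs. [folklore] -/
theorem posEnv_card_update_lt (w : Sym2 (Fin n) → unitInterval) (s : Fin n) {z : Sym2 (Fin n)}
    (hz : z ∈ Finset.univ.filter fun z : Sym2 (Fin n) => ¬ z.IsDiag ∧ s ∉ z ∧ w z ≠ 0) :
    (Finset.univ.filter fun z' : Sym2 (Fin n) => ¬ z'.IsDiag ∧ s ∉ z' ∧ Function.update w z 0 z' ≠ 0).card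
      < (Finset.univ.filter fun z' : Sym2 (Fin n) => ¬ z'.IsDiag ∧ s ∉ z' ∧ w z' ≠ 0).card := by
  apply Finset.card_lt_card
  refine ⟨fun f hf => ?_, fun hsub => ?_⟩
  · simp only [Finset.mem_filter, Finset.mem_univ, true_and] at hf ⊢
    refine ⟨hf.1, hf.2.1, ?_⟩
    have h := hf.2.2
    by_cases hfz : f = z
    · rw [hfz, Function.update_self] at h; exact absurd rfl h
    · rwa [Function.update_of_ne hfz] at h
  · have h := hsub hz
    simp only [Finset.mem_filter, Finset.mem_univ, true_and, Function.update_self] at h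
    exact h.2.2 rfl

/-- **(Br) when the target is the port**: equality. [this work] -/
theorem branchLemma_self (w : Sym2 (Fin n) → unitInterval) (s w₀ : Fin n) :
    (prodBernoulli w).real (openConn s w₀)ᶜ * (prodBernoulli w).real (openConn w₀ w₀ ∪ openConn s w₀)
      ≤ (prodBernoulli w).real (openConn w₀ w₀ \ openConn s w₀)
        + 2 * (prodBernoulli w).real ((openConn s w₀)ᶜ ∩ (openConn w₀ w₀)ᶜ ∩ openConn s w₀) := by
  have huniv : (openConn w₀ w₀ : Set (BondConfig (Fin n))) = Set.univ :=
    Set.eq_univ_of_forall fun _ => SimpleGraph.Reachable.refl w₀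
  rw [huniv, Set.univ_union, probReal_univ, mul_one, ← Set.compl_eq_univ_sdiff, Set.compl_univ, Set.inter_empty,
    Set.empty_inter, measureReal_empty]
  linarith

/-- **(Br) when the target lies outside the port's tree**: the two root connections are independent. [this work] -/
theorem branchLemma_of_not_reachable (w : Sym2 (Fin n) → unitInterval) {s w₀ t : Fin n} (hw₀ : w₀ ≠ s)
    (ht : ¬ (SimpleGraph.fromEdgeSet {z : Sym2 (Fin n) | s ∉ z ∧ w z ≠ 0}).Reachable w₀ t) :
    (prodBernoulli w).real (openConn s w₀)ᶜ * (prodBernoulli w).real (openConn t w₀ ∪ openConn s t)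
      ≤ (prodBernoulli w).real (openConn t w₀ \ openConn s w₀)
        + 2 * (prodBernoulli w).real ((openConn s w₀)ᶜ ∩ (openConn t w₀)ᶜ ∩ openConn s t) := by
  set H := SimpleGraph.fromEdgeSet {z : Sym2 (Fin n) | s ∉ z ∧ w z ≠ 0} with hH
  set L : Set (Fin n) := {x | (H.deleteEdges ∅).Reachable w₀ x}
  have hsL : s ∉ L := apexForest_root_not_mem w hw₀ _
  have hwL : w₀ ∈ L := SimpleGraph.Reachable.refl w₀
  have htL : t ∉ L := fun h => ht (h.mono (SimpleGraph.deleteEdges_le _))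
  have hs1 : s ∈ insert s L := Set.mem_insert s L
  have hw1 : w₀ ∈ insert s L := Set.mem_insert_of_mem s hwL
  have hcross : ∀ x y : Fin n, x ∈ L → y ∉ L → y ≠ s → w s(x, y) = 0 :=
    fun x y hx hy hys => apexForest_cross w hw₀ ∅ hx hy hys (Set.notMem_empty _)
  set G : Set (BondConfig (Fin n)) := {ω | ∀ e', w e' = 0 → e' ∉ ω}
  have hG1 : (prodBernoulli w).real G = 1 := real_sureClosed w
  have hωG : ∀ ω ∈ G, ∀ x y : Fin n, x ∈ L → y ∉ L → y ≠ s → s(x, y) ∉ ω :=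
    fun ω hω x y hx hy hys => hω _ (hcross x y hx hy hys)
  set Wn : Set (BondConfig (Fin n)) := openConnIn (insert s L) s w₀
  set Tf : Set (BondConfig (Fin n)) := openConnIn Lᶜ s t
  have c_sw : ∀ ω ∈ G, (ω ∈ openConn s w₀ ↔ ω ∈ Wn) := fun ω hω => bridge_conn_ll L hsL (hωG ω hω) hs1 hw1
  have c_st : ∀ ω ∈ G, (ω ∈ openConn s t ↔ ω ∈ Tf) := fun ω hω => by
    rw [bridge_conn_lr L hsL (hωG ω hω) hs1 htL]
    exact ⟨fun h => h.2, fun h => ⟨⟨hs1, hs1, SimpleGraph.Reachable.refl _⟩, h⟩⟩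
  have c_tw : ∀ ω ∈ G, (ω ∈ openConn t w₀ ↔ ω ∈ Tf ∧ ω ∈ Wn) := fun ω hω => by
    rw [bridge_conn_rl L hsL (hωG ω hω) htL hw1]
    exact ⟨fun h => ⟨openConnIn_symm' h.1, h.2⟩, fun h => ⟨openConnIn_symm' h.1, h.2⟩⟩
  have hdiff : ∀ {A B : Set (BondConfig (Fin n))} {K' : Set (Sym2 (Fin n))},
      DeterminedBy A K' → DeterminedBy B K' → DeterminedBy (A \ B) K' := by
    intro A B K' hA hB
    rw [determinedBy_iff] at hA hB ⊢
    intro ω ω' h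
    rw [Set.mem_sdiff, Set.mem_sdiff, hA ω ω' h, hB ω ω' h]
  have eA : (prodBernoulli w).real (openConn s w₀)ᶜ = (prodBernoulli w).real (Set.univ \ Wn) :=
    real_congr_of_sure hG1 fun ω hω => by
      rw [Set.mem_compl_iff, c_sw ω hω, Set.mem_sdiff]; exact ⟨fun h => ⟨Set.mem_univ _, h⟩, fun h => h.2⟩
  have eZ : (prodBernoulli w).real (openConn t w₀ ∪ openConn s t) = (prodBernoulli w).real Tf :=
    real_congr_of_sure hG1 fun ω hω => by
      rw [Set.mem_union, c_tw ω hω, c_st ω hω]; exact ⟨fun h => h.elim (fun h' => h'.1) id, fun h => Or.inr h⟩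
  have eH : (prodBernoulli w).real ((openConn s w₀)ᶜ ∩ (openConn t w₀)ᶜ ∩ openConn s t)
      = (prodBernoulli w).real (Set.univ \ Wn) * (prodBernoulli w).real Tf := by
    rw [← indep_blocks w L s (hdiff (determinedBy_univ _) (IncStarCutVertex.determinedBy_openConnIn_offDiag _ s w₀))
      (IncStarCutVertex.determinedBy_openConnIn_offDiag _ s t)]
    refine real_congr_of_sure hG1 fun ω hω => ?_
    simp only [Set.mem_inter_iff, Set.mem_compl_iff, Set.mem_sdiff, Set.mem_univ, true_and, c_sw ω hω, c_tw ω hω, c_st ω hω]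
    tauto
  have hD : 0 ≤ (prodBernoulli w).real (openConn t w₀ \ openConn s w₀) := measureReal_nonneg
  rw [eA, eZ, eH]
  nlinarith [mul_nonneg (measureReal_nonneg : 0 ≤ (prodBernoulli w).real (Set.univ \ Wn))
    (measureReal_nonneg : 0 ≤ (prodBernoulli w).real Tf)]

/-- **THE BRANCH LEMMA (Br) on every apex-forest.**  If the environment `fromEdgeSet {z | s ∉ z ∧ w z ≠ 0}` is acyclic and `w₀ ≠ s`, then
`P(w₀↛s)·P(t↔w₀ ∨ s↔t) ≤ P(t↔w₀ ∧ w₀↛s) + 2·P(w₀↛s ∧ t↮w₀ ∧ s↔t)` for every vertex `t`. [this work] -/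
theorem branchLemma (w : Sym2 (Fin n) → unitInterval) {s w₀ : Fin n} (t : Fin n) (hw₀ : w₀ ≠ s)
    (hforest : (SimpleGraph.fromEdgeSet {z : Sym2 (Fin n) | s ∉ z ∧ w z ≠ 0}).IsAcyclic) :
    (prodBernoulli w).real (openConn s w₀)ᶜ * (prodBernoulli w).real (openConn t w₀ ∪ openConn s t)
      ≤ (prodBernoulli w).real (openConn t w₀ \ openConn s w₀)
        + 2 * (prodBernoulli w).real ((openConn s w₀)ᶜ ∩ (openConn t w₀)ᶜ ∩ openConn s t) := by
  suffices hN : ∀ (N : ℕ) (w : Sym2 (Fin n) → unitInterval) (w₀ : Fin n), w₀ ≠ s →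
      (SimpleGraph.fromEdgeSet {z : Sym2 (Fin n) | s ∉ z ∧ w z ≠ 0}).IsAcyclic →
      (Finset.univ.filter fun z : Sym2 (Fin n) => ¬ z.IsDiag ∧ s ∉ z ∧ w z ≠ 0).card ≤ N →
      (prodBernoulli w).real (openConn s w₀)ᶜ * (prodBernoulli w).real (openConn t w₀ ∪ openConn s t)
        ≤ (prodBernoulli w).real (openConn t w₀ \ openConn s w₀)
          + 2 * (prodBernoulli w).real ((openConn s w₀)ᶜ ∩ (openConn t w₀)ᶜ ∩ openConn s t) from
    hN _ w w₀ hw₀ hforest le_rfl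
  intro N
  induction N with
  | zero =>
    -- no positive environment pair: either `t = w₀` or `t` is unreachable from `w₀`
    intro w w₀ hw₀ _ hN
    by_cases htw : t = w₀
    · subst htw; exact branchLemma_self w s t
    refine branchLemma_of_not_reachable w hw₀ fun hr => ?_
    obtain ⟨p⟩ := hr
    cases p with
    | nil => exact htw rfl
    | cons hadj _r =>
      rename_i x
      rw [SimpleGraph.fromEdgeSet_adj] at hadj
      have hmem : s(w₀, x) ∈ Finset.univ.filter (fun z : Sym2 (Fin n) => ¬ z.IsDiag ∧ s ∉ z ∧ w z ≠ 0) := by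
        simp only [Finset.mem_filter, Finset.mem_univ, true_and, Sym2.mk_isDiag_iff]
        exact ⟨hadj.2, hadj.1.1, hadj.1.2⟩
      have := Finset.card_pos.2 ⟨_, hmem⟩
      omega
  | succ N ih =>
    intro w w₀ hw₀ hforest hN
    by_cases htw : t = w₀
    · subst htw; exact branchLemma_self w s t
    set H := SimpleGraph.fromEdgeSet {z : Sym2 (Fin n) | s ∉ z ∧ w z ≠ 0} with hH
    by_cases hr : H.Reachable w₀ t
    swap
    · exact branchLemma_of_not_reachable w hw₀ hr
    -- the neighbour `x₁` of `w₀` on the tree path to `t`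
    have key : ∀ q : H.Walk w₀ t, q.IsPath → ∃ x₁ : Fin n, H.Adj w₀ x₁ ∧ (H.deleteEdges {s(x₁, w₀)}).Reachable x₁ t := by
      intro q hq
      cases q with
      | nil => exact absurd rfl htw
      | cons hadj r =>
        rename_i x₁
        refine ⟨x₁, hadj, SimpleGraph.reachable_deleteEdges_iff_exists_walk.2 ⟨r, fun he => ?_⟩⟩
        exact ((SimpleGraph.Walk.cons_isPath_iff hadj r).1 hq).2 (r.snd_mem_support_of_mem_edges he)
    obtain ⟨p⟩ := hr
    obtain ⟨x₁, hadj, hreach₁⟩ := key p.bypass p.bypass_isPath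
    have hx₁s : x₁ ≠ s := by
      intro h
      rw [hH, SimpleGraph.fromEdgeSet_adj] at hadj
      exact hadj.1.1 (h ▸ Sym2.mem_mk_right w₀ x₁)
    have hadj' : H.Adj x₁ w₀ := hadj.symm
    have hbridge : ¬ (H.deleteEdges {s(x₁, w₀)}).Reachable x₁ w₀ :=
      SimpleGraph.isBridge_iff.1 (SimpleGraph.isAcyclic_iff_forall_adj_isBridge.1 hforest hadj')
    -- the near side of the bridge `s(x₁, w₀)`
    set L : Set (Fin n) := {x | (H.deleteEdges {s(x₁, w₀)}).Reachable x₁ x}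
    have hsL : s ∉ L := apexForest_root_not_mem w hx₁s _
    have hxL : x₁ ∈ L := SimpleGraph.Reachable.refl x₁
    have hwL : w₀ ∉ L := hbridge
    have htL : t ∈ L := hreach₁
    have hcross : ∀ x y : Fin n, x ∈ L → y ∉ L → y ≠ s → s(x, y) ≠ s(x₁, w₀) → w s(x, y) = 0 :=
      fun x y hx hy hys hne => apexForest_cross w hx₁s {s(x₁, w₀)} hx hy hys (by rwa [Set.mem_singleton_iff])
    -- the pinned instance has fewer positive environment pairs and an acyclic environment
    have hw0 : w s(x₁, w₀) ≠ 0 := by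
      rw [hH, SimpleGraph.fromEdgeSet_adj] at hadj'
      exact hadj'.1.2
    have hz : s(x₁, w₀) ∈ Finset.univ.filter (fun z : Sym2 (Fin n) => ¬ z.IsDiag ∧ s ∉ z ∧ w z ≠ 0) := by
      rw [hH, SimpleGraph.fromEdgeSet_adj] at hadj'
      simp only [Finset.mem_filter, Finset.mem_univ, true_and, Sym2.mk_isDiag_iff]
      exact ⟨hadj'.2, hadj'.1.1, hadj'.1.2⟩
    have IH := ih (Function.update w s(x₁, w₀) 0) x₁ hx₁s (hforest.anti (envGraph_update_le w s _ 0 (Or.inr rfl)))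
      (by have := posEnv_card_update_lt w s hz; omega)
    exact branchLemma_bridge_step w L hsL hxL hwL htL hcross IH

end IncStar

end Summit.CriticalPhenomena.PercolationContinuityZ3.Theorems
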